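/-
Copyright: H21 programme, solo seat `solo-RiemannHypothesis-informed` (session 4).
-/
import Summits.RiemannHypothesis.RiemannHypothesis.Theorems.SoloInformedLocalThreshold

/-!
# The plateau family and its gain (solo-informed, T14)

The explicit odd test family for the conditional threshold theorem (paper (D8)(vi)):
`b_a(t) = ST(a − t)·ST(a + t)` with `ST = Real.smoothTransition` is a smooth plateau bump,
equal to `1` on `[1 − a, a − 1]`, vanishing off `(−a, a)`, with a transition layer of FIXED
width `1` (so its derivative bounds do not depend on `a`), and
`h_{η,a}(t) = sinh(ηt)·b_a(t)` (`sinhPlateau η a`) is an odd Weil test supported in `[−a, a]`.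

The GAIN estimate: `∫ h_{η,a}(t) e^{ηt} dt = ∫ sinh²(ηt) b_a(t) dt` (oddness kills the
`sinh·cosh` part), which is real, non-negative, and at least
`∫_{1−a}^{a−1} sinh²(ηt) dt = sinh(2η(a−1))/(2η) − (a−1)` (`gain_sinhPlateau`), i.e. `≍ e^{2|η|a}`.
Squared, this is the `e^{4|η|a}`-size pair gain that the exclusion form
`pair_gain_le_of_weilGroundEnergy_nonneg` must accommodate; the norms on its right side are
`O(e^{2|η|a})` (Leibniz bounds, not formalised here), whence the double-logarithmic window.

Main results: `isWeilTest_sinhPlateau`, `integral_sinhPlateau_mul_cexp`, `integral_sinh_sq`,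
`gain_sinhPlateau`.
-/

open MeasureTheory Complex Set Filter Topology Literature.NumberTheory.LFunctions
open scoped ContDiff

namespace Summit.RiemannHypothesis.RiemannHypothesis.Theorems

/-! ## The plateau bump -/

/-- The plateau bump `b_a(t) = ST(a − t)·ST(a + t)`, `ST = Real.smoothTransition` (layer width `1`,
plateau `[1 − a, a − 1]`; not the `[0,1]`-plateau `Literature…JelliumBoseGas.plateau`). -/
noncomputable def windowPlateau (a t : ℝ) : ℝ :=
  Real.smoothTransition (a - t) * Real.smoothTransition (a + t)

/-- `0 ≤ b_a`. -/
theorem windowPlateau_nonneg (a t : ℝ) : 0 ≤ windowPlateau a t :=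
  mul_nonneg (Real.smoothTransition.nonneg _) (Real.smoothTransition.nonneg _)

/-- `b_a ≤ 1`. -/
theorem windowPlateau_le_one (a t : ℝ) : windowPlateau a t ≤ 1 :=
  mul_le_one₀ (Real.smoothTransition.le_one _) (Real.smoothTransition.nonneg _)
    (Real.smoothTransition.le_one _)

/-- `b_a` is even. -/
theorem windowPlateau_even (a t : ℝ) : windowPlateau a (-t) = windowPlateau a t := by
  unfold windowPlateau; rw [mul_comm]; congr 1; ring_nf

/-- `b_a = 1` on the plateau `|t| ≤ a − 1`. -/
theorem windowPlateau_eq_one {a t : ℝ} (ht : |t| ≤ a - 1) : windowPlateau a t = 1 := by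
  have h1 : 1 ≤ a - t := by linarith [le_abs_self t]
  have h2 : 1 ≤ a + t := by linarith [neg_abs_le t]
  unfold windowPlateau
  rw [Real.smoothTransition.one_of_one_le h1, Real.smoothTransition.one_of_one_le h2, mul_one]

/-- `b_a = 0` off `(−a, a)`. -/
theorem windowPlateau_eq_zero {a t : ℝ} (ht : a ≤ |t|) : windowPlateau a t = 0 := by
  unfold windowPlateau
  rcases le_or_gt 0 t with h | h
  · rw [abs_of_nonneg h] at ht
    rw [Real.smoothTransition.zero_of_nonpos (by linarith), zero_mul]
  · rw [abs_of_neg h] at ht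
    rw [Real.smoothTransition.zero_of_nonpos (by linarith : a + t ≤ 0), mul_zero]

/-- `b_a` is smooth. -/
theorem contDiff_windowPlateau (a : ℝ) : ContDiff ℝ ∞ (windowPlateau a) := by
  unfold windowPlateau
  exact (Real.smoothTransition.contDiff.comp (contDiff_const.sub contDiff_id)).mul
    (Real.smoothTransition.contDiff.comp (contDiff_const.add contDiff_id))

/-- `b_a` is continuous. -/
theorem continuous_windowPlateau (a : ℝ) : Continuous (windowPlateau a) := (contDiff_windowPlateau a).continuous

/-- `tsupport b_a ⊆ [−a, a]`. -/
theorem tsupport_windowPlateau_subset (a : ℝ) : tsupport (windowPlateau a) ⊆ Icc (-a) a := by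
  refine closure_minimal ?_ isClosed_Icc
  intro t ht
  rw [Function.mem_support] at ht
  by_contra hI
  apply ht
  apply windowPlateau_eq_zero
  rcases not_and_or.mp (fun h ↦ hI (mem_Icc.mpr h)) with h | h
  · push Not at h; linarith [neg_le_abs t]
  · push Not at h; linarith [le_abs_self t]

/-- `b_a` has compact support. -/
theorem hasCompactSupport_windowPlateau (a : ℝ) : HasCompactSupport (windowPlateau a) :=
  HasCompactSupport.of_support_subset_isCompact isCompact_Icc
    (subset_tsupport _ |>.trans (tsupport_windowPlateau_subset a))

/-! ## The odd family `sinh(ηt)·b_a(t)` -/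

/-- `h_{η,a}(t) = sinh(ηt)·b_a(t)` as a complex-valued test function. -/
noncomputable def sinhPlateau (η a : ℝ) : ℝ → ℂ :=
  fun t ↦ ((Real.sinh (η * t) * windowPlateau a t : ℝ) : ℂ)

/-- `h_{η,a}` is odd. -/
theorem sinhPlateau_odd (η a t : ℝ) : sinhPlateau η a (-t) = -sinhPlateau η a t := by
  unfold sinhPlateau
  rw [windowPlateau_even, mul_neg, Real.sinh_neg]
  push_cast; ring

/-- `h_{η,a}` is smooth. -/
theorem contDiff_sinhPlateau (η a : ℝ) : ContDiff ℝ ∞ (sinhPlateau η a) := by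
  unfold sinhPlateau
  exact Complex.ofRealCLM.contDiff.comp (((contDiff_const.mul contDiff_id).sinh).mul
    (contDiff_windowPlateau a))

/-- `tsupport h_{η,a} ⊆ [−a, a]`. -/
theorem tsupport_sinhPlateau_subset (η a : ℝ) : tsupport (sinhPlateau η a) ⊆ Icc (-a) a := by
  refine (closure_mono ?_).trans
    ((isClosed_Icc.closure_subset_iff).mpr (subset_tsupport _ |>.trans (tsupport_windowPlateau_subset a)))
  intro t ht
  rw [Function.mem_support] at ht ⊢
  intro h0
  apply ht
  simp [sinhPlateau, h0]

/-- `h_{η,a}` has compact support. -/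
theorem hasCompactSupport_sinhPlateau (η a : ℝ) : HasCompactSupport (sinhPlateau η a) :=
  HasCompactSupport.of_support_subset_isCompact isCompact_Icc
    (subset_tsupport _ |>.trans (tsupport_sinhPlateau_subset η a))

/-- `h_{η,a}` is a Weil test function. -/
theorem isWeilTest_sinhPlateau (η a : ℝ) : IsWeilTest (sinhPlateau η a) :=
  ⟨contDiff_sinhPlateau η a, hasCompactSupport_sinhPlateau η a⟩

/-! ## The gain -/

/-- **Gain identity.** `∫ h_{η,a}(t) e^{ηt} dt = ∫ sinh²(ηt) b_a(t) dt` (a real number): the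
`sinh·cosh·b_a` part is odd and integrates to zero. -/
theorem integral_sinhPlateau_mul_cexp (η a : ℝ) :
    ∫ t : ℝ, sinhPlateau η a t * cexp ((η : ℂ) * t) =
      ((∫ t : ℝ, Real.sinh (η * t) ^ 2 * windowPlateau a t : ℝ) : ℂ) := by
  have hsplit : ∀ t : ℝ, sinhPlateau η a t * cexp ((η : ℂ) * t) =
      ((Real.sinh (η * t) * windowPlateau a t * Real.cosh (η * t) : ℝ) : ℂ) +
        ((Real.sinh (η * t) ^ 2 * windowPlateau a t : ℝ) : ℂ) := by
    intro t
    unfold sinhPlateau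
    rw [show ((η : ℂ) * t) = ((η * t : ℝ) : ℂ) by push_cast; ring, ← Complex.ofReal_exp,
      ← Real.cosh_add_sinh]
    push_cast; ring
  simp_rw [hsplit]
  -- the odd part
  set f : ℝ → ℝ := fun t ↦ Real.sinh (η * t) * windowPlateau a t * Real.cosh (η * t) with hf
  have hfodd : ∀ t, f (-t) = -f t := by
    intro t; simp only [hf, windowPlateau_even, mul_neg, Real.sinh_neg, Real.cosh_neg]; ring
  have hf0 : ∫ t : ℝ, f t = 0 := by
    have h1 := integral_neg_eq_self f volume
    simp only [hfodd, integral_neg] at h1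
    linarith
  have hfc : Continuous f := by
    simp only [hf]
    exact ((Real.continuous_sinh.comp (continuous_const.mul continuous_id)).mul
      (continuous_windowPlateau a)).mul (Real.continuous_cosh.comp (continuous_const.mul continuous_id))
  have hfi : Integrable f := by
    refine hfc.integrable_of_hasCompactSupport ?_
    refine (hasCompactSupport_windowPlateau a).mul_left.mul_right
  have hgc : Continuous fun t : ℝ ↦ Real.sinh (η * t) ^ 2 * windowPlateau a t :=
    ((Real.continuous_sinh.comp (continuous_const.mul continuous_id)).pow 2).mul
      (continuous_windowPlateau a)
  have hgi : Integrable fun t : ℝ ↦ Real.sinh (η * t) ^ 2 * windowPlateau a t :=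
    hgc.integrable_of_hasCompactSupport (hasCompactSupport_windowPlateau a).mul_left
  rw [integral_add (hfi.ofReal) (hgi.ofReal), integral_complex_ofReal, integral_complex_ofReal]
  rw [show (fun t ↦ Real.sinh (η * t) * windowPlateau a t * Real.cosh (η * t)) = f from rfl, hf0]
  simp

/-- `∫_{−c}^{c} sinh²(ηt) dt = sinh(2ηc)/(2η) − c` (`η ≠ 0`). -/
theorem integral_sinh_sq {η : ℝ} (hη : η ≠ 0) (c : ℝ) :
    ∫ t in (-c)..c, Real.sinh (η * t) ^ 2 = Real.sinh (2 * η * c) / (2 * η) - c := by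
  have hderiv : ∀ t : ℝ, HasDerivAt (fun t : ℝ ↦ Real.sinh (2 * η * t) / (4 * η) - t / 2)
      (Real.sinh (η * t) ^ 2) t := by
    intro t
    have h1 : HasDerivAt (fun t : ℝ ↦ Real.sinh (2 * η * t)) (Real.cosh (2 * η * t) * (2 * η)) t := by
      have := ((hasDerivAt_id t).const_mul (2 * η)).sinh
      simpa using this
    have h2 : HasDerivAt (fun t : ℝ ↦ Real.sinh (2 * η * t) / (4 * η) - t / 2)
        (Real.cosh (2 * η * t) * (2 * η) / (4 * η) - 1 / 2) t :=
      (h1.div_const (4 * η)).sub ((hasDerivAt_id t).div_const 2)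
    convert h2 using 1
    rw [Real.sinh_sq, show 2 * η * t = 2 * (η * t) by ring, Real.cosh_two_mul, Real.sinh_sq]
    field_simp
    ring
  rw [intervalIntegral.integral_eq_sub_of_hasDerivAt (fun t _ ↦ hderiv t)
    ((Continuous.pow (Real.continuous_sinh.comp (continuous_const.mul continuous_id)) 2
      ).intervalIntegrable _ _)]
  simp only [mul_neg, Real.sinh_neg, neg_div]
  ring

/-- **Gain lower bound.** For `η > 0` and `a ≥ 1`:
`sinh(2η(a−1))/(2η) − (a−1) ≤ ‖∫ h_{η,a}(t) e^{ηt} dt‖`. -/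
theorem gain_sinhPlateau {η a : ℝ} (hη : 0 < η) (ha : 1 ≤ a) :
    Real.sinh (2 * η * (a - 1)) / (2 * η) - (a - 1) ≤
      ‖∫ t : ℝ, sinhPlateau η a t * cexp ((η : ℂ) * t)‖ := by
  rw [integral_sinhPlateau_mul_cexp, Complex.norm_real, Real.norm_eq_abs]
  refine le_trans ?_ (le_abs_self _)
  have hgc : Continuous fun t : ℝ ↦ Real.sinh (η * t) ^ 2 * windowPlateau a t :=
    ((Real.continuous_sinh.comp (continuous_const.mul continuous_id)).pow 2).mul
      (continuous_windowPlateau a)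
  have hgi : Integrable fun t : ℝ ↦ Real.sinh (η * t) ^ 2 * windowPlateau a t :=
    hgc.integrable_of_hasCompactSupport (hasCompactSupport_windowPlateau a).mul_left
  have hnn : 0 ≤ᵐ[volume] fun t : ℝ ↦ Real.sinh (η * t) ^ 2 * windowPlateau a t :=
    Eventually.of_forall fun t ↦ mul_nonneg (sq_nonneg _) (windowPlateau_nonneg a t)
  -- restrict to the plateau
  have hset : ∫ t in Icc (-(a - 1)) (a - 1), Real.sinh (η * t) ^ 2 * windowPlateau a t
      ≤ ∫ t : ℝ, Real.sinh (η * t) ^ 2 * windowPlateau a t := setIntegral_le_integral hgi hnn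
  refine le_trans (le_of_eq ?_) hset
  have hcongr : ∫ t in Icc (-(a - 1)) (a - 1), Real.sinh (η * t) ^ 2 * windowPlateau a t =
      ∫ t in Icc (-(a - 1)) (a - 1), Real.sinh (η * t) ^ 2 := by
    refine setIntegral_congr_fun measurableSet_Icc fun t ht ↦ ?_
    rw [windowPlateau_eq_one (abs_le.mpr ⟨by linarith [ht.1], ht.2⟩), mul_one]
  rw [hcongr, integral_Icc_eq_integral_Ioc, ← intervalIntegral.integral_of_le (by linarith),
    integral_sinh_sq hη.ne']

end Summit.RiemannHypothesis.RiemannHypothesis.Theorems
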